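import Literature.AlgebraicGeometry.Frobenioids.Prop55SubRatStdRlfClosers2
import Literature.AlgebraicGeometry.Frobenioids.UnitTrivializationBiratCompactRlf
import HarnessLib

/-!
# Frobenioids I, Proposition 5.5 (iii), "Finally" (rationally standard type) — the repaired slot
# `Prop55iii_untr_rlf_ratStd'` PROVED (unconditionally)

Mochizuki, *The geometry of Frobenioids I: the general theory*, Kyushu J. Math. **62** (2008)
293–400, §5, Proposition 5.5 (iii) p. 104 ll. 37–39 ("Finally, if, moreover, `C` is not of group-like
type, then if `C` is of standard (respectively, rationally standard) type, then so are `C^un-tr`,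
`C^rlf`"), proof p. 105 ll. 20–27. [cite: MochizukiFrdI2008, Prop. 5.5 (iii) p.104]

Proof-only capstone (cell abc-iut, sub-DAG S7 row `FrdI:Prop5.5(iii)/P55-L07`, rationally standard half,
seat abc-iut-w5-d250) of the repaired slot `FrdI.Prop55Sub.Prop55iii_untr_rlf_ratStd' F hF hΦ`
(`Prop55SubRatStdSlot.lean`; GAP row P55iii-F1 of the cell: the original slot's support predicate for
`Φ^rlf` was a free binder, the repaired slot uses THE support `PrimarySupp` of Def. 2.4 (i)(d) on both
sides). The last named input (K) "`((C^rlf)^un-tr)^birat` admits a Frobenius-compact object" (print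
p. 105 ll. 20–22: "since `(C^un-tr)^birat` admits a Frobenius-compact object, the same is true for
`(C^rlf)^birat`") is now the theorem `PreFrobenioid.Birat.exists_isFrobeniusCompact_untrBirat_rlf` (seat
abc-iut-L1-t2, `UnitTrivializationBiratCompactRlf.lean`: the λ-rigidity transfer along
`Φ^gp ↪ (Φ^rlf)^gp`), fed with the Frobenius-compact object of `(C^un-tr)^birat` that "`C` of rationally
standard type" provides (Def. 4.5 (iii)(b)); the inputs (H), (N) were discharged in
`Prop55SubRatStdRlfClosers2.lean`. Hence:
* `FrdI.Prop55Sub.prop55iii_untr_rlf_ratStd'_holds (hF) (hΦ) : Prop55iii_untr_rlf_ratStd' F hF hΦ` — for a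
  Frobenioid `C → F_Φ` over a perf-factorial `Φ`, NOT of group-like type and of rationally standard type,
  `C^un-tr` is of rationally standard type and so is `C^rlf` for every Frobenioid structure `hR` on
  `C^rlf → F_{Φ^rlf}` (the slot's binder; supplied in general by sub-DAG W3, Prop. 5.3). The slot's
  antecedents "Frobenius-isotropic / Frobenius-normalized type" are not used (as in print, where they serve
  item (i) only).
No statement of the paper is strengthened; nothing here bears on [IUTchIII] Cor. 3.12.
-/

namespace Literature.AlgebraicGeometry.Frobenioids

open CategoryTheory Opposite

universe w v v' u u'

namespace FrdI.Prop55Sub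

open PreFrobenioid PreFrobenioidData

variable {D : Type u} [Category.{v} D] {Φ : Dᵒᵖ ⥤ CommMonCat.{w}}
  {C : Type u'} [Category.{v'} C] (F : C ⥤ ElemFrobenioid Φ)

/-- **Proposition 5.5 (iii), "Finally", rationally standard type — the repaired slot
`Prop55iii_untr_rlf_ratStd'` PROVED**: for a Frobenioid `C → F_Φ` with `Φ` perf-factorial, NOT of group-like
type and of rationally standard type (THE parameters, support `PrimarySupp`), the unit-trivialization
`C^un-tr` is of rationally standard type (`prop55iii_untr_ratStd_of`, unconditional), and THE realification
`C^rlf` is of rationally standard type for every Frobenioid structure on `C^rlf → F_{Φ^rlf}`: Def. 4.5 (iii)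
clause by clause — birationally Frobenius-normalized (seat abc-iut-L1-d2), rational
(`isRational_rlf_of`), standard (seat abc-iut-w4-d084), and (b) a Frobenius-compact object of
`((C^rlf)^un-tr)^birat` transferred from the one of `(C^un-tr)^birat` (seat abc-iut-L1-t2's
`exists_isFrobeniusCompact_untrBirat_rlf`). [cite: MochizukiFrdI2008, Prop. 5.5 (iii) p.104] -/
theorem prop55iii_untr_rlf_ratStd'_holds (hF : IsFrobenioid F) (hΦ : IsPerfFactorialOn Φ) :
    Prop55iii_untr_rlf_ratStd' F hF hΦ := by
  intro _ _ hng h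
  refine ⟨prop55iii_untr_ratStd_of F hF _ hng h, fun hR => ?_⟩
  obtain ⟨Y, hY⟩ := Birat.exists_isFrobeniusCompact_untrBirat_rlf (F := F) hF hΦ h.frobCompact hR
  exact isOfRationallyStandardType_rlf_of_frobCompact F hF hΦ hng h hR Y hY

end FrdI.Prop55Sub

end Literature.AlgebraicGeometry.Frobenioids
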